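import Literature.MathematicalPhysics.QuantumFieldTheory.Chatterjee2019LargeN.StrongCoupling
import Mathlib.Combinatorics.Enumerative.Catalan.Basic
import Mathlib.Analysis.SpecificLimits.Basic
import Mathlib.Analysis.Normed.Group.InfiniteSum
import HarnessLib

/-!
# Chatterjee 2019: the master loop equations (finite `N` unsymmetrized, 't Hooft limit, uniqueness) and the recursion for the strong-coupling coefficients `a_k(s)` — §§4, 8, 9, 10 as named facts

S. Chatterjee, *Rigorous solution of strongly coupled `SO(N)` lattice gauge theory in the large `N`
limit*, Comm. Math. Phys. **366** (2019) 203–268 (arXiv:1502.07719). Statement-level transcription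
(named facts `def … : Prop`, D-0014; hypothesis-free definitions of the printed objects) for the
cross-ladder literature-typing layer (R141 (D), item (3), third file of the directory). The sibling
modules are `LatticeStrings` (§2: loops, loop sequences, the string operations, trajectories, weights)
and `StrongCoupling` (§3: the model `μ_{Λ,N,β}`, `W_l`, `φ_{Λ,N,β}`, `a_k(s) = coeffA`, and the named
facts Theorem 3.1 = `GaugeStringDuality`, Corollaries 3.2–3.5, Theorem 3.6 =
`FiniteNMasterLoopEquation`, the SYMMETRIZED finite-`N` equation). NOTHING about the lattice theory is
proved here except bookkeeping implications between the typed statements.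

## What this file adds (all locators = CMP numbering = arXiv v7)

* **§8, Theorem 8.1** `UnsymmetrizedMasterLoopEquation` — the finite-`N` master loop equation AT A
  MARKED EDGE `e` of `l₁`: `(N-1) m ⟨W_{l₁}⋯W_{lₙ}⟩ = twisting + splitting + merger + deformation terms`,
  `m` = the number of occurrences of `e^{±1}` in `l₁` (Theorem 3.6 is its symmetrization over `e`).
* **§9, Theorem 9.1** `THooftMasterLoopEquation` — «the master loop equation in the 't Hooft limit»:
  EVERY subsequential limit `φ_β(s) = lim ⟨W_{l₁}⋯W_{lₙ}⟩_{Λ_N,N,β}/Nⁿ` satisfies, for EVERY real `β`,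
  `m φ_β(s) = splitting term + β · deformation term` (mergers and twistings drop out). This is the
  rigorous `N = ∞` Makeenko–Migdal equation of `SO(N)` lattice gauge theory with free boundary
  condition, valid «irrespective of the value of `β`» (source, after the proof of Thm 9.1); the
  predicate `SatisfiesMasterLoopEquation φ β` isolates the equation itself.
* **§9, Theorem 9.2** `MasterLoopUniqueness` (for `|β| ≤ β₀(L,d)` the equation has exactly one solution
  with `φ(∅) = 1`, `|φ(s)| ≤ L^{|s|}`) and its printed consequence `THooftLimit` (for `|β| ≤ β₀(d)` the
  't Hooft limit `φ_β(s)` exists for every `s`), the latter PROVED here from `GaugeStringDuality`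
  (`thooftLimit_of_gaugeStringDuality`).
* **§9, Theorem 9.9** `SymmetrizedLimitMasterLoopEquation` — `|s| φ_β(s) = ∑_{𝕊⁻} φ_β - ∑_{𝕊⁺} φ_β
  + β ∑_{𝔻⁻} φ_β - β ∑_{𝔻⁺} φ_β` for `|β| ≤ β₀(d)`, over the operation index types of `LatticeStrings`.
* **§9 definitions** size `#s`, index `ι(s) = |s| - #s` (`LoopSeq.size`, `LoopSeq.index`) and
  **Lemma 9.8** `SplittingLowersIndex` (the termination certificate of the §4 algorithm) — PROVED in
  v1.3 (`SplittingLowersIndex_holds`, last section).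
* **§4 / §10** the recursion for `a_k(s)` at a marked edge: `CoeffRecursion` (= the inductive
  definition opening §10 together with **Proposition 4.1**: the §4 algorithm terminates and returns
  `a_k(s) = ∑_{X ∈ 𝒳ₖ(s)} v(X)`), **Lemma 10.1** `CoeffCatalanBound`
  (`|a_k(s)| ≤ K(d)^{5k+ι(s)} ∏ C_{|lᵢ|-1}`, Catalan numbers), **Corollary 10.4** `SymmetrizedCoeffRecursion`
  — PROVED in v1.4 (`SymmetrizedCoeffRecursion_holds`, with `finite_trajectoryWith`: `𝒳ₖ(s)` is finite).
* **§4, last paragraph — the printed numbers**: for a plaquette `p` in `ℤ³`, `a₀,…,a₅ = 0, 1, 0, 0, 0, -7`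
  (`plaquetteCoeffZ3`, `PlaquetteCoefficientsZ3`) and `lim_{N→∞} ⟨W_p⟩/N = β - 7β⁵ + O(β⁶)`
  (`PlaquetteExpansionZ3`), the latter DERIVED here from Corollary 3.5 and the former
  (`plaquetteExpansionZ3_of`, with `isLoop_plaquetteWord`, `phi_singleton`).

## Dictionary and rendering choices

* «Let `e` be the first edge of `l₁`» (Thm 8.1; Thm 9.1 and §10 refer back to it), «Let `e` be an
  arbitrary edge in `l₁`» (§4). The source's loops are CYCLES whose first edge is fixed «by some
  arbitrary rule» (§2.1); this directory works with based representatives (`LatticeStrings`, flag F1).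
  We therefore mark the edge by a LOCATION `x₀ : Fin l₁.length` of the representative and put
  `e := l₁[x₀]`: every location is the first edge of a cyclically equivalent representative, so this is
  the printed statement for every admissible «arbitrary rule» at once (flag F1 below).
* `A₁ = {x : l₁[x] = e}`, `B₁ = {x : l₁[x] = e⁻¹}`, `C₁ = A₁ ∪ B₁`, `m = |C₁|` (Thm 8.1) ↔ `Word.locs l e`
  (`C₁`), `Word.occ l e` (`m`), and the pair sets `Word.invPairs l e` (`A₁ × B₁ ∪ B₁ × A₁`),
  `Word.samePairs l e` (`{(x,y) ∈ A₁² ∪ B₁² : x ≠ y}`), over which the printed four-fold sums with equal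
  signs are merged into two (same value, term by term).
* The four «terms» of Thm 8.1 ↔ `twistTermAt`, `splitTermAt`, `mergeTermAt`, `deformTermAt`, generic
  in the evaluation `F : LoopSeq d → ℝ` of the resulting loop sequence: `F = ⟨W_{l'₁} W_{l'₂} ⋯⟩` (the
  UNREDUCED list, `W_∅ = N` as the source defines, `wilsonLoopVar_nil`) for Thm 8.1;
  `F = φ ∘ prune` (value of a function of loop sequences on the minimal representation,
  `LoopSeq.prune`) for Thms 9.1/9.2 and the `a_k`-recursion. The string operations at locations are
  those of `LatticeStrings` (`Word.negSplit₁/₂`, `posSplit₁/₂`, `negTwist`, `posTwist`, `negMerge`,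
  `posMerge`, `negDeform`, `posDeform`; `plaquettesAt e = 𝒫⁺(e)`).
* «`φ_β : 𝒮 → ℝ`» (Thm 9.2), a function of loop sequences = sequences of cycles modulo null loops ↔ a
  function `φ : LoopSeq d → ℝ` used only on genuine minimal representations (`IsLoopSeq`) and required
  to be a function of the underlying cycles there (`IsCycleFunction`: invariance under rotating a
  component).

## Faithfulness flags

* (F1) Marked location instead of «first edge» (see above); for `x₀ = 0` it is literally the source's.
* (F2) Thm 8.1 does not require `Λ` non-empty or `s` non-null separately: the vertex hypothesis («all
  vertices of `ℤ^d` at distance `≤ 1` from any of the loops in `s` are contained in `Λ`», rendered as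
  in `FiniteNMasterLoopEquation`, flag F6 there) and `s = (l₁, …)` genuine with `l₁` present make both
  automatic. `N ≥ 2`, `β` real, `d ≥ 2` as printed/assumed throughout the source.
* (F3) Thm 9.1: «take a subsequence of `N`'s such that along this subsequence, the limit of
  `φ_{Λ_N,N,β}(s)` exists for every loop sequence `s`» ↔ a strictly increasing `ν : ℕ → ℕ` and a
  function `φ` with `φ_{Λ_{ν k},ν k,β}(s) → φ(s)` for every genuine `s`; NO restriction on `β`.
* (F4) Thm 9.2: `∃!` is rendered as existence plus uniqueness ON GENUINE LOOP SEQUENCES (values of a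
  Lean function elsewhere are junk); condition (b) `|φ(s)| ≤ L^{|s|}` and (c) are imposed on genuine
  `s`; (c) is the equation of Thm 9.1 at every marked location (equivalent to «first edge» for cycle
  functions, flag F1).
* (F5) `LoopSeq.size s = s.length` and `LoopSeq.index s = |s| - #s` (truncated subtraction on `ℕ`; for
  genuine `s`, `|s| ≥ 4 #s` by Lemma 9.7, so nothing is truncated).
* (F6) §4's numbers are a COMPUTER CALCULATION reported in print («implemented on a standard laptop
  computer using a code written in the R programming language»); they are typed as printed and not
  re-derived here. «`O(β⁶)`» ↔ `|f(β) - (β - 7β⁵)| ≤ C|β|⁶` for `|β| ≤ β₀` (the function is a power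
  series absolutely convergent on `|β| ≤ β₀(3)`, Cor. 3.5).
* (F7) Thm 7.1 (a two-function Schwinger–Dyson/Stein identity for Haar measure on `SO(N)`) and the
  existence half of Thm 11.1 are NOT transcribed: the latter is the `Summable` clause of
  `GaugeStringDuality`; for the former the tree holds one-link Schwinger–Dyson identities for compact
  groups on the Summit side (`Summit.QuantumFields.GaugeBoot.loopEquation_of_sdPair` and the files it
  cites), which a Literature module may not import.
* (F8) (tree status, 2026-08-27) Of the printed table, rows `k ≤ 4` («`a₀ = 0, a₁ = 1, a₂ = a₃ = a₄ = 0`») are THEOREMS in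
  every dimension (`coeffA_plaquette_zero` in `AreaLowerBound`, `coeffA_plaquette_one` in `PlaquetteFirstOrder`,
  `coeffA_plaquette_of_even` in `AreaParity`, `coeffA_plaquette_three` and the package
  `plaquetteCoefficientsZ3_of_lt_five` in `PlaquetteThirdOrder`). The row `k = 5` («`a₅ = −7`») is DISPUTED: evaluating
  the printed algorithm on the definitions of `LatticeStrings`/`LoopOperations` — both the symmetrized recursion of
  Corollary 10.4 (`Factorization.len_mul_coeffA`) and §4's unsymmetrized recursion, with and without canonicalisation and
  pruning — gives `a₅((p)) = +2` for `d = 3` (`2(d-2)` for `d = 2, …, 6`; at `d = 2` all `a_k`, `k ≥ 2`, vanish, as they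
  must in planar lattice gauge theory). Until the discrepancy with print is resolved, `PlaquetteCoefficientsZ3` (through its
  row `k = 5`) and `PlaquetteExpansionZ3` («`-7β⁵`») should not be used as hypotheses; the order-`β⁵` form of §4's display
  that does not depend on that row is `plaquetteExpansion_order_five_of_realAnalyticity` (`PlaquetteThirdOrder`). No kernel
  refutation is in the tree (it would need a verified evaluator of `coeffA`).

## Related tree results (cited, not restated)

* `Summit.QuantumFields.GaugeBoot.loopEquation_specialUnitaryGroup` / `loopEquation_unitaryGroup`:
  PROVED finite-`N` single-link loop equations for `SU(N)`/`U(N)` on the discrete torus, whose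
  docstring names the present source's finite-`N` master loop equation as the summed-over-marks form.
  The present file is the `SO(N)`, free-boundary, and — Theorems 9.1/9.2/9.9 — the `N = ∞` side.
* `Literature.MathematicalPhysics.QuantumFieldTheory.AndersonKruczenski2017.*`,
  `…KazakovZheng2023.*` (cross-ladder items (11)): large-`N` loop-equation bootstrap INPUT statements;
  Theorem 9.1 here is the rigorous statement that every `N → ∞` limit point of `SO(N)` lattice gauge
  theory satisfies the loop equation at every `β`.

## References

* S. Chatterjee, Comm. Math. Phys. 366 (2019) 203–268, doi:10.1007/s00220-019-03353-3,
  arXiv:1502.07719: §4 (algorithm, Proposition 4.1, the `ℤ³` plaquette numbers), §8 (Theorem 8.1),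
  §9 (Theorems 9.1, 9.2, 9.9; size, index, Lemmas 9.7, 9.8), §10 (definition of `a_k`, Lemma 10.1,
  Theorem 10.3, Corollary 10.4, proof of Proposition 4.1). [Chatterjee2019LargeN]
* Yu. M. Makeenko, A. A. Migdal, Phys. Lett. B 88 (1979) 135 (the loop equations, as cited in §3 of
  the source).
-/

noncomputable section

open MeasureTheory Filter Topology
open Literature.Probability.LatticeModels Literature.MathematicalPhysics.QuantumLattice

namespace Literature.MathematicalPhysics.QuantumFieldTheory.Chatterjee2019LargeN

variable {d : ℕ}

/-! ### §9: size and index of a loop sequence -/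

namespace LoopSeq

/-- The **size** `#s = n` of a loop sequence with minimal representation `(l₁, …, lₙ)` (the number of
component loops; `#∅ = 0`). [cite: Chatterjee2019LargeN, §9 (definition of #s, before Lemma 9.7)] -/
def size (s : LoopSeq d) : ℕ := s.length

/-- The **index** `ι(s) = |s| - #s` of a loop sequence (`ι(∅) = 0`; truncated subtraction, flag F5).
[cite: Chatterjee2019LargeN, §9 (definition of ι(s), before Lemma 9.7)] -/
def index (s : LoopSeq d) : ℕ := s.len - s.size

/-- `#∅ = 0`. [cite: Chatterjee2019LargeN, §9 («The size and the index of the null loop sequence are define[d] to be zero»)] -/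
theorem size_nil : size ([] : LoopSeq d) = 0 := rfl

/-- `ι(∅) = 0`. [cite: Chatterjee2019LargeN, §9 (index of the null loop sequence)] -/
theorem index_nil : index ([] : LoopSeq d) = 0 := rfl

end LoopSeq

/-! ### §8: the marked edge — occurrence sets `A₁`, `B₁`, `C₁`, the multiplicity `m`, and the four terms of Theorem 8.1 -/

namespace Word

/-- `C₁ = A₁ ∪ B₁`: the locations of `l` carrying the marked edge `e` or its inverse `e⁻¹`.
[cite: Chatterjee2019LargeN, Theorem 8.1 (the sets A_r, B_r, C_r)] -/
def locs (l : Word d) (e : DEdge d) : Finset (Fin l.length) :=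
  Finset.univ.filter fun x => l.get x = e ∨ l.get x = DEdge.inv e

/-- `m = |C₁|`: the number of occurrences of `e^{±1}` in `l`. [cite: Chatterjee2019LargeN, Theorem 8.1 («let m be the size of C₁»)] -/
def occ (l : Word d) (e : DEdge d) : ℕ := (locs l e).card

/-- The ordered pairs of locations `(x, y) ∈ A₁ × B₁ ∪ B₁ × A₁`: `e` at one, `e⁻¹` at the other (the
index set of the negative splittings / positive twistings at the marked edge).
[cite: Chatterjee2019LargeN, Theorem 8.1 (sums over x ∈ A₁, y ∈ B₁ and x ∈ B₁, y ∈ A₁)] -/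
def invPairs (l : Word d) (e : DEdge d) : Finset (Fin l.length × Fin l.length) :=
  Finset.univ.filter fun xy =>
    (l.get xy.1 = e ∧ l.get xy.2 = DEdge.inv e) ∨ (l.get xy.1 = DEdge.inv e ∧ l.get xy.2 = e)

/-- The ordered pairs of DISTINCT locations `(x, y)`, `x ≠ y`, both in `A₁` or both in `B₁`: the same
letter `e` (or `e⁻¹`) at both (the index set of the positive splittings / negative twistings at the
marked edge). [cite: Chatterjee2019LargeN, Theorem 8.1 (sums over x, y ∈ A₁, x ≠ y and x, y ∈ B₁, x ≠ y)] -/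
def samePairs (l : Word d) (e : DEdge d) : Finset (Fin l.length × Fin l.length) :=
  Finset.univ.filter fun xy =>
    xy.1 ≠ xy.2 ∧ l.get xy.1 = l.get xy.2 ∧ (l.get xy.1 = e ∨ l.get xy.1 = DEdge.inv e)

end Word

/-- The **splitting term** at the marked edge `e` of the first component `l` of the loop sequence
`(l, l₂, …, lₙ)` (`rest = (l₂, …, lₙ)`), for an evaluation `F` of loop sequences:
`∑_{x∈A₁,y∈B₁} F(×¹_{x,y} l, ×²_{x,y} l, l₂, …) + ∑_{x∈B₁,y∈A₁} F(⋯) - ∑_{x≠y∈A₁} F(×¹_{x,y} l, ×²_{x,y} l, l₂, …)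
 - ∑_{x≠y∈B₁} F(⋯)` (negative splittings at inverse pairs, positive splittings at equal pairs).
[cite: Chatterjee2019LargeN, Theorem 8.1 (splitting term), Theorem 9.1 (splitting term)] -/
def splitTermAt (F : LoopSeq d → ℝ) (l : Word d) (rest : LoopSeq d) (e : DEdge d) : ℝ :=
  (∑ xy ∈ Word.invPairs l e, F (Word.negSplit₁ l xy.1 xy.2 :: Word.negSplit₂ l xy.1 xy.2 :: rest))
    - ∑ xy ∈ Word.samePairs l e, F (Word.posSplit₁ l xy.1 xy.2 :: Word.posSplit₂ l xy.1 xy.2 :: rest)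

/-- The **deformation term** (without its prefactor `Nβ`, resp. `β`, resp. `1/m`):
`∑_{p∈𝒫⁺(e)} ∑_{x∈C₁} F(l ⊖ₓ p, l₂, …) - ∑_{p∈𝒫⁺(e)} ∑_{x∈C₁} F(l ⊕ₓ p, l₂, …)`.
[cite: Chatterjee2019LargeN, Theorem 8.1 (deformation term), Theorem 9.1 (deformation term), §4 (recursion)] -/
def deformTermAt (F : LoopSeq d → ℝ) (l : Word d) (rest : LoopSeq d) (e : DEdge d) : ℝ :=
  (∑ p ∈ plaquettesAt e, ∑ x ∈ Word.locs l e, F (Word.negDeform l x p :: rest))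
    - ∑ p ∈ plaquettesAt e, ∑ x ∈ Word.locs l e, F (Word.posDeform l x p :: rest)

/-- The **twisting term** of Theorem 8.1:
`∑_{x≠y∈A₁} F(∝_{x,y} l, l₂, …) + ∑_{x≠y∈B₁} F(⋯) - ∑_{x∈A₁,y∈B₁} F(∝_{x,y} l, l₂, …) - ∑_{x∈B₁,y∈A₁} F(⋯)`
(negative twistings at equal pairs, positive twistings at inverse pairs).
[cite: Chatterjee2019LargeN, Theorem 8.1 (twisting term)] -/
def twistTermAt (F : LoopSeq d → ℝ) (l : Word d) (rest : LoopSeq d) (e : DEdge d) : ℝ :=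
  (∑ xy ∈ Word.samePairs l e, F (Word.negTwist l xy.1 xy.2 :: rest))
    - ∑ xy ∈ Word.invPairs l e, F (Word.posTwist l xy.1 xy.2 :: rest)

/-- The **merger term** of Theorem 8.1:
`∑_{r=2}^{n} ∑_{x∈C₁,y∈C_r} F(l ⊖_{x,y} l_r, (l_t)_{t≠1,r}) - ∑_{r=2}^{n} ∑_{x∈C₁,y∈C_r} F(l ⊕_{x,y} l_r, (l_t)_{t≠1,r})`,
`C_r` the locations of `e^{±1}` in `l_r` (the merged loop first, then the remaining components in
their order). [cite: Chatterjee2019LargeN, Theorem 8.1 (merger term)] -/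
def mergeTermAt (F : LoopSeq d → ℝ) (l : Word d) (rest : LoopSeq d) (e : DEdge d) : ℝ :=
  (∑ j : Fin rest.length, ∑ x ∈ Word.locs l e, ∑ y ∈ Word.locs (rest.get j) e,
      F (Word.negMerge l x (rest.get j) y :: rest.eraseIdx j))
    - ∑ j : Fin rest.length, ∑ x ∈ Word.locs l e, ∑ y ∈ Word.locs (rest.get j) e,
      F (Word.posMerge l x (rest.get j) y :: rest.eraseIdx j)

/-! ### §8, Theorem 8.1: the unsymmetrized finite-`N` master loop equation (NAMED FACT) -/

variable (d)

/-- **Theorem 8.1 (finite-`N` master loop equation at a marked edge).** «Take any `N ≥ 2`, `β ∈ ℝ` and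
a finite set `Λ ⊆ ℤ^d`, and consider `SO(N)` lattice gauge theory on `Λ` at inverse coupling strength
`β`. Take a loop sequence `s` with minimal representation `(l₁, …, lₙ)` such that all vertices of `ℤ^d`
that are at distance `≤ 1` from any of the loops in `s` are contained in `Λ`. Let `e` be the first
edge of `l₁`. For each `1 ≤ r ≤ n`, let `A_r` be the set of locations in `l_r` where `e` occurs, and
let `B_r` be the set of locations in `l_r` where `e⁻¹` occurs. Let `C_r = A_r ∪ B_r`, and let `m` be
the size of `C₁`. Then `(N-1) m ⟨W_{l₁} W_{l₂} ⋯ W_{lₙ}⟩ = twisting term + splitting term + merger term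
+ deformation term`», with the four terms as in `twistTermAt`, `splitTermAt`, `mergeTermAt` and
`Nβ · deformTermAt`, evaluated by `F(s') = ⟨∏_{l' ∈ s'} W_{l'}⟩_{Λ,N,β}` on the unreduced resulting
list (`W_∅ = N`). «In all of the above, empty sums denote zero.» Rendering: marked location `x₀` of
`l₁` with `e = l₁[x₀]` (flag F1); vertex hypothesis as in `FiniteNMasterLoopEquation` (flag F2).
[cite: Chatterjee2019LargeN, Theorem 8.1] -/
def UnsymmetrizedMasterLoopEquation : Prop :=
  2 ≤ d → ∀ Λ : Finset (Literature.Probability.LatticeModels.Site d),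
    ∀ N : ℕ, 2 ≤ N → ∀ (β : ℝ) (l : Word d) (rest : LoopSeq d), IsLoopSeq (l :: rest) →
      (∀ l' ∈ l :: rest, ∀ a ∈ l', ∀ v : Literature.Probability.LatticeModels.Site d,
          latticeNorm (v - DEdge.src a) ≤ 1 ∨ latticeNorm (v - DEdge.tgt a) ≤ 1 → v ∈ Λ) →
        ∀ x₀ : Fin l.length,
          ((N : ℝ) - 1) * (Word.occ l (l.get x₀) : ℝ) * soExpect N β Λ (wilsonProd N (l :: rest)) =
            twistTermAt (fun s' => soExpect N β Λ (wilsonProd N s')) l rest (l.get x₀)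
            + splitTermAt (fun s' => soExpect N β Λ (wilsonProd N s')) l rest (l.get x₀)
            + mergeTermAt (fun s' => soExpect N β Λ (wilsonProd N s')) l rest (l.get x₀)
            + N * β * deformTermAt (fun s' => soExpect N β Λ (wilsonProd N s')) l rest (l.get x₀)

variable {d}

/-! ### §9, Theorem 9.1: the master loop equation in the 't Hooft limit -/

/-- `φ` **satisfies the master loop equation of Theorem 9.1 at inverse coupling `β`**: for every
genuine non-null loop sequence `(l₁, l₂, …, lₙ)` and every marked location `x₀` of `l₁`, with
`e = l₁[x₀]` and `m = |C₁|`,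
`m φ(l₁, …, lₙ) = splitting term + β · deformation term`, i.e.
`m φ(s) = ∑_{x∈A₁,y∈B₁} φ(×¹_{x,y}l₁, ×²_{x,y}l₁, l₂, …) + ∑_{x∈B₁,y∈A₁} φ(⋯) - ∑_{x≠y∈A₁} φ(×¹_{x,y}l₁, ×²_{x,y}l₁, …)
 - ∑_{x≠y∈B₁} φ(⋯) + β ∑_{p∈𝒫⁺(e)} ∑_{x∈C₁} φ(l₁ ⊖ₓ p, l₂, …) - β ∑_{p∈𝒫⁺(e)} ∑_{x∈C₁} φ(l₁ ⊕ₓ p, l₂, …)`,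
`φ` being evaluated on minimal representations (`prune`). [cite: Chatterjee2019LargeN, Theorem 9.1 (the equation), Theorem 9.2 (c)] -/
def SatisfiesMasterLoopEquation (φ : LoopSeq d → ℝ) (β : ℝ) : Prop :=
  ∀ (l : Word d) (rest : LoopSeq d), IsLoopSeq (l :: rest) → ∀ x₀ : Fin l.length,
    (Word.occ l (l.get x₀) : ℝ) * φ (l :: rest) =
      splitTermAt (fun s' => φ (LoopSeq.prune s')) l rest (l.get x₀)
        + β * deformTermAt (fun s' => φ (LoopSeq.prune s')) l rest (l.get x₀)

variable (d)

/-- **Theorem 9.1 (the master loop equation in the 't Hooft limit).** «Let `Λ_N` be a sequence of sets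
increasing to `ℤ^d`, and take a subsequence of `N`'s such that along this subsequence, the limit of
`φ_{Λ_N,N,β}(s)` exists for every loop sequence `s`. Call this limit `φ_β(s)`. Take any loop sequence `s`
with minimal representation `(l₁, …, lₙ)`. Let `e`, `m`, `A₁`, `B₁` and `C₁` be as in Theorem 8.1. Then
`m φ_β(s) = splitting term + deformation term`» (displayed as in `SatisfiesMasterLoopEquation`). «The
notable thing about Theorem 9.1 is that it is true irrespective of the value of `β`.» Rendering (flag
F3): for every `d ≥ 2`, every exhaustion `Λ`, EVERY real `β`, every strictly increasing `ν : ℕ → ℕ` and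
every `φ` with `φ_{Λ_{ν k}, ν k, β}(s) → φ(s)` for all genuine `s`, `φ` satisfies the master loop
equation at `β`. [cite: Chatterjee2019LargeN, Theorem 9.1] -/
def THooftMasterLoopEquation : Prop :=
  2 ≤ d → ∀ Λ : ℕ → Finset (Literature.Probability.LatticeModels.Site d), IsExhaustion Λ →
    ∀ (β : ℝ) (ν : ℕ → ℕ), StrictMono ν →
      ∀ φ : LoopSeq d → ℝ,
        (∀ s : LoopSeq d, IsLoopSeq s →
            Tendsto (fun k : ℕ => phi (ν k) β (Λ (ν k)) s) atTop (𝓝 (φ s))) →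
          SatisfiesMasterLoopEquation φ β

variable {d}

/-- Bookkeeping corollary of the rendering: under `THooftMasterLoopEquation`, a full (not only
subsequential) 't Hooft limit `φ` satisfies the master loop equation (take `ν = id`).
[cite: Chatterjee2019LargeN, Theorem 9.1] -/
theorem satisfiesMasterLoopEquation_of_tendsto (h : THooftMasterLoopEquation d) (hd : 2 ≤ d)
    {Λ : ℕ → Finset (Literature.Probability.LatticeModels.Site d)} (hΛ : IsExhaustion Λ) {β : ℝ}
    {φ : LoopSeq d → ℝ}
    (hφ : ∀ s : LoopSeq d, IsLoopSeq s → Tendsto (fun N : ℕ => phi N β (Λ N) s) atTop (𝓝 (φ s))) :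
    SatisfiesMasterLoopEquation φ β :=
  h hd Λ hΛ β id strictMono_id φ fun s hs => hφ s hs

/-! ### §9, Theorem 9.2: uniqueness of the solution and existence of the 't Hooft limit -/

/-- `φ` is a **function of the underlying cycles** on genuine loop sequences: rotating the
representative of any component does not change the value (the source's `φ_β` is a function on the
set `𝒮` of loop sequences, whose components are cycles). [cite: Chatterjee2019LargeN, §2.1 (cycles; «fixing the first edge of a cycle by some arbitrary rule»), Theorem 9.2 (φ_β : 𝒮 → ℝ)] -/
def IsCycleFunction (φ : LoopSeq d → ℝ) : Prop :=
  ∀ s : LoopSeq d, IsLoopSeq s → ∀ i k : ℕ, φ (s.modify i fun l => l.rotate k) = φ s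

/-- The solution class of Theorem 9.2 at `(L, β)`: «(a) `φ_β(∅) = 1`, (b) `|φ_β(s)| ≤ L^{|s|}` for all
`s`, and (c) `φ_β` satisfies the master loop equation of Theorem 9.1», for a cycle function `φ`
(flag F4). [cite: Chatterjee2019LargeN, Theorem 9.2 (conditions (a)–(c))] -/
def IsMasterLoopSolution (L β : ℝ) (φ : LoopSeq d → ℝ) : Prop :=
  IsCycleFunction φ ∧ φ [] = 1 ∧ (∀ s : LoopSeq d, IsLoopSeq s → |φ s| ≤ L ^ s.len) ∧
    SatisfiesMasterLoopEquation φ β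

variable (d)

/-- **Theorem 9.2 (uniqueness), first part.** «Given any `L ≥ 1`, there exists `β₀(L,d) > 0` such that
if `|β| ≤ β₀(L,d)`, then there is a unique function `φ_β : 𝒮 → ℝ` such that (a) `φ_β(∅) = 1`, (b)
`|φ_β(s)| ≤ L^{|s|}` for all `s`, and (c) `φ_β` satisfies the master loop equation of Theorem 9.1.»
Rendering (flag F4): existence of some `φ` in the class `IsMasterLoopSolution L β`, and any two members
of the class agree on every genuine loop sequence. [cite: Chatterjee2019LargeN, Theorem 9.2 (first sentence)] -/
def MasterLoopUniqueness : Prop :=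
  2 ≤ d → ∀ L : ℝ, 1 ≤ L → ∃ β₀ : ℝ, 0 < β₀ ∧ ∀ β : ℝ, |β| ≤ β₀ →
    (∃ φ : LoopSeq d → ℝ, IsMasterLoopSolution L β φ) ∧
      ∀ φ φ' : LoopSeq d → ℝ, IsMasterLoopSolution L β φ → IsMasterLoopSolution L β φ' →
        ∀ s : LoopSeq d, IsLoopSeq s → φ s = φ' s

/-- **Theorem 9.2, second part (existence of the 't Hooft limit).** «Consequently, there exists
`β₀(d) > 0` such that for `|β| ≤ β₀(d)`, `φ_{Λ_N,N,β}(s)` converges to a limit `φ_β(s)` as `N → ∞` for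
every loop sequence `s`.» (For every exhaustion `Λ_N ↑ ℤ^d` as in §9 ¶1.) Discharged below from
Theorem 3.1. [cite: Chatterjee2019LargeN, Theorem 9.2 (last sentence)] -/
def THooftLimit : Prop :=
  2 ≤ d → ∃ β₀ : ℝ, 0 < β₀ ∧
    ∀ Λ : ℕ → Finset (Literature.Probability.LatticeModels.Site d), IsExhaustion Λ →
      ∀ β : ℝ, |β| ≤ β₀ → ∀ s : LoopSeq d, IsLoopSeq s →
        ∃ L : ℝ, Tendsto (fun N : ℕ => phi N β (Λ N) s) atTop (𝓝 L)

variable {d}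

/-- The 't Hooft limit exists (Theorem 9.2, second part) as a consequence of the main theorem
(Theorem 3.1 = `GaugeStringDuality`, which identifies the limit). [cite: Chatterjee2019LargeN, Theorem 9.2, Theorem 3.1] -/
theorem thooftLimit_of_gaugeStringDuality (h : GaugeStringDuality d) : THooftLimit d := by
  intro hd
  obtain ⟨β₀, hβ₀, H⟩ := h hd
  exact ⟨β₀, hβ₀, fun Λ hΛ β hβ s hs => ⟨_, (H Λ hΛ β hβ s hs).2⟩⟩

/-! ### §9, Theorem 9.9: the symmetrized limiting master loop equation (NAMED FACT) -/

variable (d)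

/-- **Theorem 9.9 (symmetrized master loop equation in the 't Hooft limit).** «Let `β₀(d)` and `φ_β` be
as in Theorem 9.2. Then for any non-null loop sequence `s` and `|β| ≤ β₀(d)`,
`|s| φ_β(s) = ∑_{s'∈𝕊⁻(s)} φ_β(s') - ∑_{s'∈𝕊⁺(s)} φ_β(s') + β ∑_{s'∈𝔻⁻(s)} φ_β(s') - β ∑_{s'∈𝔻⁺(s)} φ_β(s')`.»
Rendering: `φ_β` = the 't Hooft limit of `φ_{Λ_N,N,β}` along any exhaustion (it exists for
`|β| ≤ β₀(d)`, `THooftLimit`); the four sums run over the operation index types `InvIdx s` (`𝕊⁻`),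
`SameIdx s` (`𝕊⁺`), `DeformIdx s` (`𝔻^∓`) of `LatticeStrings` with their result maps (counted with
multiplicity, as in Theorem 3.6). [cite: Chatterjee2019LargeN, Theorem 9.9] -/
def SymmetrizedLimitMasterLoopEquation : Prop :=
  2 ≤ d → ∃ β₀ : ℝ, 0 < β₀ ∧
    ∀ Λ : ℕ → Finset (Literature.Probability.LatticeModels.Site d), IsExhaustion Λ →
      ∀ β : ℝ, |β| ≤ β₀ → ∀ φ : LoopSeq d → ℝ,
        (∀ s : LoopSeq d, IsLoopSeq s → Tendsto (fun N : ℕ => phi N β (Λ N) s) atTop (𝓝 (φ s))) →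
          ∀ s : LoopSeq d, IsLoopSeq s → s ≠ [] →
            (s.len : ℝ) * φ s =
              (∑ o : InvIdx s, φ (s.negSplitAt o)) - (∑ o : SameIdx s, φ (s.posSplitAt o))
                + β * (∑ o : DeformIdx s, φ (s.negDeformAt o))
                - β * (∑ o : DeformIdx s, φ (s.posDeformAt o))

/-! ### §9, Lemma 9.8: splitting lowers the index (NAMED FACT; the termination certificate of §4) -/

/-- **Lemma 9.8.** «If `s'` is obtained from `s` by a splitting operation, then `ι(s') < ι(s)`.» (Proof in
the source: Lemmas 9.3/9.5 give `#s' = #s + 1` and `|s'| ≤ |s|`.) This is the fact that makes the §4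
recursion terminate («either `k` is replaced by `k - 1` or `s` is replaced by a loop sequence of smaller
index», proof of Proposition 4.1, end of §10). Rendering over the index types of `LatticeStrings`.
[cite: Chatterjee2019LargeN, Lemma 9.8; proof of Proposition 4.1 (§10)] -/
def SplittingLowersIndex : Prop :=
  2 ≤ d → ∀ s : LoopSeq d, IsLoopSeq s →
    (∀ o : SameIdx s, (s.posSplitAt o).index < s.index) ∧
      ∀ o : InvIdx s, (s.negSplitAt o).index < s.index

/-! ### §4 / §10: base values of `a_k(∅)` (PROVED from the definitions of `LatticeStrings`) -/

variable {d}

/-- The null loop sequence admits no move (all four operation index types of `∅` are empty).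
[cite: Chatterjee2019LargeN, §2.2 (operations act on components; ∅ has none)] -/
theorem isEmpty_move_nil : IsEmpty (Move ([] : LoopSeq d)) :=
  ⟨fun m => by
    cases m with
    | posDeform o => exact Fin.elim0 o.1
    | negDeform o => exact Fin.elim0 o.1
    | posSplit o => exact Fin.elim0 o.1
    | negSplit o => exact Fin.elim0 o.1⟩

/-- `𝒳(∅) = {(∅)}`: the only vanishing trajectory of the null loop sequence is the trivial one.
[cite: Chatterjee2019LargeN, §2.2 («If s = ∅, then 𝒳(s) consists of only one trajectory»)] -/
theorem trajectory_nil_eq_nil (X : Trajectory ([] : LoopSeq d)) : X = Trajectory.nil := by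
  cases X with
  | nil => rfl
  | cons m X => exact (isEmpty_move_nil.false m).elim

/-- `a₀(∅) = 1`. [cite: Chatterjee2019LargeN, §4 («If s is the null loop sequence, then it outputs a₀(s) = 1»), §10] -/
theorem coeffA_nil_zero : coeffA ([] : LoopSeq d) 0 = 1 := by
  unfold coeffA
  rw [tsum_eq_single ⟨Trajectory.nil, rfl⟩]
  · rfl
  · intro X hX
    exact (hX (Subtype.ext (trajectory_nil_eq_nil X.1))).elim

/-- `a_k(∅) = 0` for `k ≥ 1`. [cite: Chatterjee2019LargeN, §4 («and a_k(s) = 0 for every k > 0»), §10] -/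
theorem coeffA_nil_of_pos {k : ℕ} (hk : 1 ≤ k) : coeffA ([] : LoopSeq d) k = 0 := by
  haveI : IsEmpty (TrajectoryWith ([] : LoopSeq d) k) :=
    ⟨fun X => by
      have h := X.2
      rw [trajectory_nil_eq_nil X.1] at h
      simp [Trajectory.numDeform] at h
      omega⟩
  exact tsum_empty

variable (d)

/-! ### §4 / §10: the recursion for the coefficients `a_k(s)` (NAMED FACTS) -/

/-- **The recursion of §4 / the inductive definition opening §10, and Proposition 4.1.** §10: «define
`a₀(∅) = 1` and `a₀(s) = 0` for every non-null `s`. … Let `a_k(∅) = 0` [for `k ≥ 1`]. Take any non-null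
`s` with minimal representation `(l₁, …, lₙ)`. Let `e`, `m`, `A₁`, `B₁` and `C₁` be as in the statement
of Theorem 8.1. …
`a_k(s) := (1/m) ∑_{x∈A₁,y∈B₁} a_k(×¹_{x,y}l₁, ×²_{x,y}l₁, l₂, …, lₙ) + (1/m) ∑_{x∈B₁,y∈A₁} a_k(⋯)
 - (1/m) ∑_{x≠y∈A₁} a_k(×¹_{x,y}l₁, ×²_{x,y}l₁, l₂, …, lₙ) - (1/m) ∑_{x≠y∈B₁} a_k(⋯)
 + (1/m) ∑_{p∈𝒫⁺(e)} ∑_{x∈C₁} a_{k-1}(l₁ ⊖ₓ p, l₂, …, lₙ) - (1/m) ∑_{p∈𝒫⁺(e)} ∑_{x∈C₁} a_{k-1}(l₁ ⊕ₓ p, l₂, …, lₙ)`»;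
§4 states the same recursion for «an arbitrary edge `e` in `l₁`» and **Proposition 4.1**: «The
recursion described above terminates for any `k` and `s`, and gives the same `a_k(s)` as in Corollary
3.5», i.e. `a_k(s) = ∑_{X∈𝒳ₖ(s)} v(X)` = `coeffA s k`. Rendering: the base value `a₀(s) = 0` for
non-null `s` (the values at `∅` are the proved `coeffA_nil_zero`, `coeffA_nil_of_pos`) and, for every
genuine `(l₁, l₂, …)`, every marked location `x₀` (flag F1) and every `k ≥ 1`, the recursion with
`a = coeffA` on both sides (termination: `SplittingLowersIndex`).
[cite: Chatterjee2019LargeN, §10 (definition of a_k(s)), §4 and Proposition 4.1] -/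
def CoeffRecursion : Prop :=
  2 ≤ d →
    (∀ s : LoopSeq d, IsLoopSeq s → s ≠ [] → coeffA s 0 = 0) ∧
    ∀ (l : Word d) (rest : LoopSeq d), IsLoopSeq (l :: rest) → ∀ (x₀ : Fin l.length) (k : ℕ), 1 ≤ k →
      coeffA (l :: rest) k =
        (1 / (Word.occ l (l.get x₀) : ℝ)) *
            splitTermAt (fun s' => coeffA (LoopSeq.prune s') k) l rest (l.get x₀)
          + (1 / (Word.occ l (l.get x₀) : ℝ)) *
            deformTermAt (fun s' => coeffA (LoopSeq.prune s') (k - 1)) l rest (l.get x₀)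

/-- **Lemma 10.1 (Catalan bound on the coefficients).** «There is a constant `K(d)` such that if `s` is
a loop sequence and `δ = (δ₁, …, δₙ)` is its degree vector [`δᵢ = |lᵢ|`], then
`|a_k(s)| ≤ K(d)^{5k+ι(δ)} C_{δ₁-1} ⋯ C_{δₙ-1}`, where `Cᵢ` is the `i`-th Catalan number. The product of
Catalan numbers is interpreted as `1` when `s = ∅`.» (`ι(δ) = ι(s)`; Mathlib's `catalan`.) In the proof
`K ≥ 1` is chosen large. [cite: Chatterjee2019LargeN, Lemma 10.1] -/
def CoeffCatalanBound : Prop :=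
  2 ≤ d → ∃ K : ℝ, 1 ≤ K ∧ ∀ s : LoopSeq d, IsLoopSeq s → ∀ k : ℕ,
    |coeffA s k| ≤ K ^ (5 * k + s.index) * ((s.map fun l => (catalan (l.length - 1) : ℝ)).prod)

/-- **Corollary 10.4 (symmetrized recursion).** «For any non-null `s` and any `k ≥ 1`,
`a_k(s) = (1/|s|) ∑_{s'∈𝕊⁻(s)} a_k(s') - (1/|s|) ∑_{s'∈𝕊⁺(s)} a_k(s') + (1/|s|) ∑_{s'∈𝔻⁻(s)} a_{k-1}(s')
 - (1/|s|) ∑_{s'∈𝔻⁺(s)} a_{k-1}(s')`.» Over the index types of `LatticeStrings` (with multiplicity).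
[cite: Chatterjee2019LargeN, Corollary 10.4] -/
def SymmetrizedCoeffRecursion : Prop :=
  2 ≤ d → ∀ s : LoopSeq d, IsLoopSeq s → s ≠ [] → ∀ k : ℕ, 1 ≤ k →
    coeffA s k =
      (1 / (s.len : ℝ)) * (∑ o : InvIdx s, coeffA (s.negSplitAt o) k)
        - (1 / (s.len : ℝ)) * (∑ o : SameIdx s, coeffA (s.posSplitAt o) k)
        + (1 / (s.len : ℝ)) * (∑ o : DeformIdx s, coeffA (s.negDeformAt o) (k - 1))
        - (1 / (s.len : ℝ)) * (∑ o : DeformIdx s, coeffA (s.posDeformAt o) (k - 1))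

variable {d}

/-! ### §4, last paragraph: the printed plaquette coefficients in `ℤ³` (NAMED FACTS, flag F6) -/

/-- The printed first six strong-coupling coefficients of the plaquette loop in `ℤ³`:
«`a₀ = 0`, `a₁ = 1`, `a₂ = 0`, `a₃ = 0`, `a₄ = 0` and `a₅ = -7`» (index `k ↦ a_k`, `k < 6`; `0` beyond,
where nothing is printed; the entry `a₅ = -7` is disputed, flag F8). [cite: Chatterjee2019LargeN, §4 (last paragraph)] -/
def plaquetteCoeffZ3 (k : ℕ) : ℤ := if k = 1 then 1 else if k = 5 then -7 else 0

/-- `plaquetteCoeffZ3` lists `0, 1, 0, 0, 0, -7`. [cite: Chatterjee2019LargeN, §4 (last paragraph)] -/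
theorem plaquetteCoeffZ3_values :
    (List.range 6).map plaquetteCoeffZ3 = [0, 1, 0, 0, 0, -7] := by decide

/-- **§4, the computed coefficients.** «As an application of the above algorithm, take `d = 3` and `s` to
be a single plaquette in `ℤ³`. The first six coefficients computed using the above algorithm
(implemented on a standard laptop computer using a code written in the R programming language) turn out
to be `a₀ = 0`, `a₁ = 1`, `a₂ = 0`, `a₃ = 0`, `a₄ = 0` and `a₅ = -7`.» A computer calculation reported in
print, typed as printed (flag F6): for every plaquette `p` of `ℤ³` (all plaquettes are equivalent under
lattice symmetries) and `k < 6`, `a_k((p)) = plaquetteCoeffZ3 k`. Rows `k ≤ 4` are theorems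
(`plaquetteCoefficientsZ3_of_lt_five`); the row `k = 5` is DISPUTED (flag F8: the algorithm evaluates to `+2`).
[cite: Chatterjee2019LargeN, §4 (last paragraph)] -/
def PlaquetteCoefficientsZ3 : Prop :=
  ∀ p : ZdPlaquette 3, ∀ k : ℕ, k < 6 → coeffA [plaquetteWord p] k = (plaquetteCoeffZ3 k : ℝ)

/-- **§4, the displayed expansion.** «In other words, if `p` is a plaquette in `ℤ³` and `β` is small,
then `lim_{N→∞} ⟨W_p⟩_{Λ_N,N,β} / N = β - 7β⁵ + O(β⁶)`, where `Λ_N` is a sequence of finite sets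
increasing to `ℤ³`.» Rendering (flag F6): there is `β₀ > 0` and, for every plaquette `p` of `ℤ³`, a
constant `C` such that for every exhaustion `Λ` of `ℤ³` and every `|β| ≤ β₀` the limit `f` of
`⟨W_p⟩_{Λ_N,N,β}/N` exists and `|f - (β - 7β⁵)| ≤ C|β|⁶` (the `O`-constant is quoted per plaquette, as
printed; all plaquettes are equivalent under lattice symmetries). DISPUTED through the coefficient `-7` (flag F8);
the order-`β⁵` form independent of it is `plaquetteExpansion_order_five_of_realAnalyticity`.
[cite: Chatterjee2019LargeN, §4 (last display)] -/
def PlaquetteExpansionZ3 : Prop :=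
  ∃ β₀ : ℝ, 0 < β₀ ∧ ∀ p : ZdPlaquette 3, ∃ C : ℝ,
    ∀ Λ : ℕ → Finset (Literature.Probability.LatticeModels.Site 3), IsExhaustion Λ →
      ∀ β : ℝ, |β| ≤ β₀ →
        ∃ f : ℝ,
          Tendsto (fun N : ℕ => soExpect N β (Λ N) (wilsonLoopVar N (plaquetteWord p)) / N) atTop (𝓝 f) ∧
            |f - (β - 7 * β ^ 5)| ≤ C * |β| ^ 6

/-! ### §4, last display DERIVED: `PlaquetteExpansionZ3` from Corollary 3.5 (`RealAnalyticityStrongCoupling`) and the printed coefficients (PROVED) -/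

/-- A plaquette word `e₁ e₂ e₃⁻¹ e₄⁻¹` is a (based) loop: a closed nonbacktracking path of length four.
[cite: Chatterjee2019LargeN, §2.1 («A plaquette is a nonbacktracking closed path of length four»)] -/
theorem isLoop_plaquetteWord (p : ZdPlaquette d) : IsLoop (plaquetteWord p) := by
  obtain ⟨x, ⟨⟨i, j⟩, hij⟩⟩ := p
  have hne : i ≠ j := ne_of_lt hij
  refine ⟨⟨?_, ?_⟩, ?_, ?_⟩
  · simp [IsPath, plaquetteWord, DEdge.src, DEdge.tgt, add_right_comm]
  · intro h
    simp [plaquetteWord, DEdge.src, DEdge.tgt]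
  · simp [FreeGroup.IsReduced, plaquetteWord, hne, hne.symm]
  · simp [plaquetteWord, hne]

/-- The one-plaquette loop sequence `(p)` is a genuine loop sequence in minimal representation.
[cite: Chatterjee2019LargeN, §2.1 (plaquettes are loops; minimal representation)] -/
theorem isLoopSeq_plaquette (p : ZdPlaquette d) : IsLoopSeq [plaquetteWord p] := by
  intro l hl
  rw [List.mem_singleton] at hl
  subst hl
  exact ⟨isLoop_plaquetteWord p, by simp [plaquetteWord]⟩

/-- `φ_{Λ,N,β}((l)) = ⟨W_l⟩_{Λ,N,β} / N` for a one-loop sequence. [cite: Chatterjee2019LargeN, §9 ¶1 (definition of φ_{Λ,N,β})] -/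
theorem phi_singleton (N : ℕ) (β : ℝ) (Λ : Finset (Literature.Probability.LatticeModels.Site d))
    (l : Word d) : phi N β Λ [l] = soExpect N β Λ (wilsonLoopVar N l) / N := by
  have h : wilsonProd N [l] = wilsonLoopVar N l := by
    funext U; simp [wilsonProd]
  simp [phi, h]

/-- **§4, last display, derived.** Corollary 3.5 (`RealAnalyticityStrongCoupling`, at `d = 3`) and the
printed coefficients (`PlaquetteCoefficientsZ3`) imply `lim ⟨W_p⟩/N = β - 7β⁵ + O(β⁶)`
(`PlaquetteExpansionZ3`): the limit is the absolutely convergent power series `∑ a_k β^k`, its first six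
terms sum to `β - 7β⁵`, and on `|β| ≤ β₀/2` the tail is at most `(2M/β₀⁶)|β|⁶` with
`M = ∑_k |a_k| β₀^k < ∞`. [cite: Chatterjee2019LargeN, §4 («In other words …»), Corollary 3.5] -/
theorem plaquetteExpansionZ3_of (h1 : RealAnalyticityStrongCoupling 3) (h2 : PlaquetteCoefficientsZ3) :
    PlaquetteExpansionZ3 := by
  obtain ⟨β₀, hβ₀, H⟩ := h1 (by norm_num)
  refine ⟨β₀ / 2, by positivity, fun p => ?_⟩
  set s : LoopSeq 3 := [plaquetteWord p] with hs_def
  have hs : IsLoopSeq s := isLoopSeq_plaquette p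
  have hsne : s ≠ [] := List.cons_ne_nil _ _
  have hhead : ∀ β : ℝ, ∑ k ∈ Finset.range 6, coeffA s k * β ^ k = β - 7 * β ^ 5 := by
    intro β
    have hv : ∀ k, k < 6 → coeffA s k = (plaquetteCoeffZ3 k : ℝ) := fun k hk => h2 p k hk
    simp only [Finset.sum_range_succ, Finset.sum_range_zero, hv 0 (by norm_num), hv 1 (by norm_num),
      hv 2 (by norm_num), hv 3 (by norm_num), hv 4 (by norm_num), hv 5 (by norm_num), plaquetteCoeffZ3]
    norm_num
    ring
  by_cases hex : ∃ Λ₀ : ℕ → Finset (Literature.Probability.LatticeModels.Site 3), IsExhaustion Λ₀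
  swap
  · exact ⟨0, fun Λ hΛ => (hex ⟨Λ, hΛ⟩).elim⟩
  obtain ⟨Λ₀, hΛ₀⟩ := hex
  have hS0 : Summable (fun k : ℕ => coeffA s k * β₀ ^ k) :=
    (H Λ₀ hΛ₀ β₀ (by rw [abs_of_pos hβ₀]) s hs hsne).1
  set g : ℕ → ℝ := fun k => |coeffA s k| * β₀ ^ k with hg_def
  have hg : Summable g := by
    refine hS0.abs.congr fun k => ?_
    simp [g, abs_mul, abs_pow, abs_of_pos hβ₀]
  have hg0 : ∀ k, 0 ≤ g k := fun k => by positivity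
  set M : ℝ := ∑' k, g k with hM_def
  have hM0 : 0 ≤ M := tsum_nonneg hg0
  have hgM : ∀ k, g k ≤ M := fun k => hg.le_tsum k (fun j _ => hg0 j)
  refine ⟨2 * M / β₀ ^ 6, fun Λ hΛ β hβ => ?_⟩
  have hβ' : |β| ≤ β₀ := hβ.trans (by linarith)
  obtain ⟨hsum, hlim⟩ := H Λ hΛ β hβ' s hs hsne
  refine ⟨∑' k, coeffA s k * β ^ k, ?_, ?_⟩
  · refine hlim.congr' (Eventually.of_forall fun N => ?_)
    simp only [hs_def, phi_singleton]
  have hsplit := hsum.sum_add_tsum_nat_add 6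
  rw [hhead β] at hsplit
  have htail : (∑' k, coeffA s k * β ^ k) - (β - 7 * β ^ 5) =
      ∑' j, coeffA s (j + 6) * β ^ (j + 6) := by
    linarith
  rw [htail]
  set r : ℝ := |β| / β₀ with hr_def
  have hr0 : 0 ≤ r := by positivity
  have hr : r ≤ 1 / 2 := by
    rw [hr_def, div_le_iff₀ hβ₀]; linarith
  have hsum6 : Summable (fun j : ℕ => coeffA s (j + 6) * β ^ (j + 6)) := (summable_nat_add_iff 6).2 hsum
  have habs6 : Summable (fun j : ℕ => ‖coeffA s (j + 6) * β ^ (j + 6)‖) := hsum6.norm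
  have hterm : ∀ j : ℕ, ‖coeffA s (j + 6) * β ^ (j + 6)‖ ≤ M * r ^ 6 * (1 / 2) ^ j := by
    intro j
    rw [Real.norm_eq_abs, abs_mul, abs_pow]
    have hβeq : |β| = β₀ * r := by rw [hr_def]; field_simp
    rw [hβeq, mul_pow, ← mul_assoc]
    have h1' : |coeffA s (j + 6)| * β₀ ^ (j + 6) ≤ M := hgM (j + 6)
    have h2' : r ^ (j + 6) ≤ r ^ 6 * (1 / 2) ^ j := by
      rw [pow_add, mul_comm]
      exact mul_le_mul_of_nonneg_left (pow_le_pow_left₀ hr0 hr j) (by positivity)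
    calc |coeffA s (j + 6)| * β₀ ^ (j + 6) * r ^ (j + 6)
        ≤ M * (r ^ 6 * (1 / 2) ^ j) := mul_le_mul h1' h2' (by positivity) hM0
      _ = M * r ^ 6 * (1 / 2) ^ j := by ring
  have hgeo : Summable (fun j : ℕ => M * r ^ 6 * (1 / 2 : ℝ) ^ j) :=
    (summable_geometric_of_lt_one (by norm_num) (by norm_num)).mul_left _
  calc |∑' j, coeffA s (j + 6) * β ^ (j + 6)|
      = ‖∑' j, coeffA s (j + 6) * β ^ (j + 6)‖ := (Real.norm_eq_abs _).symm
    _ ≤ ∑' j, ‖coeffA s (j + 6) * β ^ (j + 6)‖ := norm_tsum_le_tsum_norm habs6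
    _ ≤ ∑' j, M * r ^ 6 * (1 / 2 : ℝ) ^ j := habs6.tsum_le_tsum hterm hgeo
    _ = M * r ^ 6 * 2 := by
        rw [tsum_mul_left, tsum_geometric_of_lt_one (by norm_num) (by norm_num)]; norm_num
    _ = 2 * M / β₀ ^ 6 * |β| ^ 6 := by
        rw [hr_def, div_pow]; field_simp

/-! ### v1.3 (append-only, 2026-08-27): Lemma 9.8 PROVED — `SplittingLowersIndex_holds`

Length bookkeeping of the two splitting operations of §2.2 on based representatives: a splitting of the component
`lᵢ` at locations `x ≠ y` (cyclic gap `g = (y − x) mod |lᵢ| ∈ [1, |lᵢ| − 1]`) replaces `lᵢ` by the nonbacktracking cores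
of two complementary arcs, of lengths `≤ |lᵢ| − g` and `≤ g` (positive splitting; `≤ |lᵢ| − g − 1`, `≤ g − 1` for the
negative one) — Lemma 9.5 `|s'| ≤ |s|` — and null cores are deleted, so `#s' = #s + 1` (Lemma 9.3) or the length
drops by a whole arc; in all cases `ι(s') = |s'| − #s' < |s| − #s = ι(s)` (`LoopSeq.index_replaceAt_two_lt`). -/

/-! ### Lemma 9.8 PROVED (`SplittingLowersIndex_holds`): length bookkeeping of the splitting operations -/

namespace Word

/-- The nonbacktracking core is no longer than the word (backtrack erasure deletes letters).
[cite: Chatterjee2019LargeN, §2.1 (nonbacktracking core)] -/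
theorem length_core_le (ρ : Word d) : (core ρ).length ≤ ρ.length := by
  have h1 : (FreeGroup.reduce ρ).length ≤ ρ.length := (FreeGroup.reduce.red (L := ρ)).sublist.length_le
  have h2 : (FreeGroup.reduceCyclically (FreeGroup.reduce ρ)).length ≤ (FreeGroup.reduce ρ).length := by
    have h := congrArg List.length (FreeGroup.reduceCyclically.conj_conjugator_reduceCyclically (FreeGroup.reduce ρ))
    simp only [List.length_append] at h
    omega
  exact h2.trans h1

/-- The cyclic gap is less than the length. [cite: Chatterjee2019LargeN, §2.1 (locations in a cycle)] -/
theorem gap_lt (l : Word d) (x y : Fin l.length) : gap l x y < l.length := (y - x).isLt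

/-- Distinct locations have a positive cyclic gap. [cite: Chatterjee2019LargeN, §2.1 (locations in a cycle)] -/
theorem gap_pos (l : Word d) {x y : Fin l.length} (h : x ≠ y) : 0 < gap l x y := by
  rw [gap]
  have hne : (x : ℕ) ≠ y := fun e => h (Fin.ext e)
  rcases le_or_gt x y with hle | hlt
  · rw [Fin.coe_sub_iff_le.mpr hle]
    have : (x : ℕ) ≤ y := hle
    omega
  · rw [Fin.coe_sub_iff_lt.mpr hlt]
    have := x.isLt
    omega

/-- `|b| ≤ gap − 1` for the arc `b` strictly between the two locations. [cite: Chatterjee2019LargeN, §2.2 (l = aebec)] -/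
theorem length_arcBetween_le (l : Word d) (x y : Fin l.length) : (arcBetween l x y).length ≤ gap l x y - 1 := by
  rw [arcBetween, List.length_take]
  exact min_le_left _ _

/-- `|c a| = |l| − gap − 1` for the arc after the second location. [cite: Chatterjee2019LargeN, §2.2 (l = aebec)] -/
theorem length_arcAfter (l : Word d) (x y : Fin l.length) :
    (arcAfter l x y).length = l.length - (gap l x y + 1) := by
  rw [arcAfter, List.length_drop, List.length_rotate]

/-- `|×¹_{x,y} l| ≤ |l| − gap` (positive splitting). [cite: Chatterjee2019LargeN, §2.2, Lemma 9.5 (|s'| ≤ |s|)] -/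
theorem length_posSplit₁_le (l : Word d) (x y : Fin l.length) : (posSplit₁ l x y).length ≤ l.length - gap l x y := by
  refine (length_core_le _).trans ?_
  rw [List.length_cons, length_arcAfter]
  have := gap_lt l x y
  omega

/-- `|×²_{x,y} l| ≤ gap` for `x ≠ y` (positive splitting). [cite: Chatterjee2019LargeN, §2.2, Lemma 9.5 (|s'| ≤ |s|)] -/
theorem length_posSplit₂_le (l : Word d) {x y : Fin l.length} (h : x ≠ y) : (posSplit₂ l x y).length ≤ gap l x y := by
  refine (length_core_le _).trans ?_
  rw [List.length_append, List.length_singleton]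
  have h1 := length_arcBetween_le l x y
  have h2 := gap_pos l h
  omega

/-- `|×¹_{x,y} l| ≤ |l| − gap − 1` (negative splitting). [cite: Chatterjee2019LargeN, §2.2, Lemma 9.5 (|s'| ≤ |s|)] -/
theorem length_negSplit₁_le (l : Word d) (x y : Fin l.length) :
    (negSplit₁ l x y).length ≤ l.length - (gap l x y + 1) :=
  (length_core_le _).trans (length_arcAfter l x y).le

/-- `|×²_{x,y} l| ≤ gap − 1` (negative splitting). [cite: Chatterjee2019LargeN, §2.2, Lemma 9.5 (|s'| ≤ |s|)] -/
theorem length_negSplit₂_le (l : Word d) (x y : Fin l.length) : (negSplit₂ l x y).length ≤ gap l x y - 1 :=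
  (length_core_le _).trans (length_arcBetween_le l x y)

end Word

namespace DEdge

/-- No directed edge is its own inverse. [cite: Chatterjee2019LargeN, §2 ¶1 (e⁻¹ ≠ e)] -/
theorem inv_ne_self (e : DEdge d) : inv e ≠ e := by
  intro h
  have := congrArg Prod.snd h
  simp [inv] at this

end DEdge

namespace LoopSeq

/-- `|s ++ t| = |s| + |t|`. [cite: Chatterjee2019LargeN, §2.1 (|s| = |l₁| + ⋯ + |lₙ|)] -/
theorem len_append (s t : LoopSeq d) : len (s ++ t) = len s + len t := by
  simp [len, List.map_append, List.sum_append]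

/-- Deleting null loops does not change the length. [cite: Chatterjee2019LargeN, §2.1 (minimal representation has the same length)] -/
theorem len_prune (s : LoopSeq d) : len (prune s) = len s := by
  induction s with
  | nil => rfl
  | cons l s ih =>
    by_cases h : l = []
    · subst h
      have : prune (([] : Word d) :: s) = prune s := by simp [prune]
      rw [this, ih, len_cons, List.length_nil, zero_add]
    · have : prune (l :: s) = l :: prune s := by simp [prune, h]
      rw [this, len_cons, len_cons, ih]

/-- `#(s ++ t) = #s + #t` (as lists). [cite: Chatterjee2019LargeN, §9 (definition of #s)] -/
theorem size_append (s t : LoopSeq d) : size (s ++ t) = size s + size t := List.length_append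

/-- A list of non-null words is already minimal. [cite: Chatterjee2019LargeN, §2.1 (minimal representation)] -/
theorem prune_eq_self {s : LoopSeq d} (h : ∀ l ∈ s, l ≠ []) : prune s = s :=
  List.filter_eq_self.mpr fun l hl => by simpa using h l hl

/-- `#s ≤ |s|` when every component is non-null. [cite: Chatterjee2019LargeN, §9 (ι(s) = |s| − #s ≥ 0)] -/
theorem size_le_len {s : LoopSeq d} (h : ∀ l ∈ s, l ≠ []) : size s ≤ len s := by
  induction s with
  | nil => exact le_rfl
  | cons l s ih =>
    have hl : 1 ≤ l.length := List.length_pos_iff.mpr (h l (by simp))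
    have ih' := ih fun l' hl' => h l' (by simp [hl'])
    simp only [size, List.length_cons, len_cons] at ih' ⊢
    omega

/-- **Index bookkeeping for a two-word replacement** (the common core of Lemma 9.8): replacing the component `lᵢ`
(`|lᵢ| ≥ a + b`, `a, b ≥ 1`) by two words of lengths `≤ a`, `≤ b` (null results deleted) strictly lowers `ι = |·| − #·`.
[cite: Chatterjee2019LargeN, Lemma 9.8 (via Lemmas 9.3 and 9.5)] -/
theorem index_replaceAt_two_lt {s : LoopSeq d} (hs : ∀ l ∈ s, l ≠ []) (i : Fin s.length) (w₁ w₂ : Word d)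
    {a b : ℕ} (ha : 1 ≤ a) (hb : 1 ≤ b) (hab : a + b ≤ (s.get i).length) (h₁ : w₁.length ≤ a)
    (h₂ : w₂.length ≤ b) : index (s.replaceAt i [w₁, w₂]) < index s := by
  -- decompose `s = A ++ lᵢ :: B`
  set A := s.take i with hA
  set B := s.drop (i + 1) with hB
  have hsplit : s = A ++ s.get i :: B := by
    rw [hA, hB, List.get_eq_getElem, List.cons_getElem_drop_succ, List.take_append_drop]
  have hAmem : ∀ l ∈ A, l ≠ [] := fun l hl => hs l (List.mem_of_mem_take hl)
  have hBmem : ∀ l ∈ B, l ≠ [] := fun l hl => hs l (List.mem_of_mem_drop hl)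
  -- the replaced sequence
  have hrep : s.replaceAt i [w₁, w₂] = A ++ prune [w₁, w₂] ++ B := by
    rw [replaceAt, prune, List.filter_append, List.filter_append, ← prune, ← prune, ← prune,
      prune_eq_self hAmem, prune_eq_self hBmem]
  -- lengths and sizes
  have hlenS : len s = len A + ((s.get i).length + len B) := by
    conv_lhs => rw [hsplit]
    rw [len_append, len_cons]
  have hsizeS : size s = size A + (1 + size B) := by
    conv_lhs => rw [hsplit]
    rw [size_append]; simp [size]; ring
  have hlenR : len (s.replaceAt i [w₁, w₂]) = len A + (w₁.length + w₂.length + len B) := by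
    rw [hrep, len_append, len_append, len_prune, len_cons, len_cons, len_nil]; ring
  have hsizeR : size (s.replaceAt i [w₁, w₂]) = size A + (size (prune [w₁, w₂]) + size B) := by
    rw [hrep, size_append, size_append, add_assoc]
  have hA' := size_le_len hAmem
  have hB' := size_le_len hBmem
  -- the size of `prune [w₁, w₂]` against the lengths
  have hδ : size (prune [w₁, w₂]) + (a - 1) + (b - 1) ≥ w₁.length + w₂.length ∧ size (prune [w₁, w₂]) ≤ 2 := by
    unfold prune size
    by_cases e1 : w₁ = [] <;> by_cases e2 : w₂ = []
    · subst e1; subst e2; simp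
    · subst e1
      have : 1 ≤ w₂.length := List.length_pos_iff.mpr e2
      simp [e2]; omega
    · subst e2
      have : 1 ≤ w₁.length := List.length_pos_iff.mpr e1
      simp [e1]; omega
    · have : 1 ≤ w₁.length := List.length_pos_iff.mpr e1
      have : 1 ≤ w₂.length := List.length_pos_iff.mpr e2
      simp [e1, e2]; omega
  unfold index
  rw [hlenR, hsizeR, hlenS, hsizeS]
  omega

/-- **Positive splittings lower the index.** [cite: Chatterjee2019LargeN, Lemma 9.8] -/
theorem index_posSplitAt_lt {s : LoopSeq d} (hs : ∀ l ∈ s, l ≠ []) (o : SameIdx s) :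
    (s.posSplitAt o).index < s.index := by
  obtain ⟨i, ⟨⟨x, y⟩, hxy, _⟩⟩ := o
  have hg := Word.gap_pos (s.get i) hxy
  have hlt := Word.gap_lt (s.get i) x y
  exact index_replaceAt_two_lt hs i _ _ (a := (s.get i).length - Word.gap (s.get i) x y)
    (b := Word.gap (s.get i) x y) (by omega) hg (by omega) (Word.length_posSplit₁_le _ x y)
    (Word.length_posSplit₂_le _ hxy)

/-- **Negative splittings lower the index.** [cite: Chatterjee2019LargeN, Lemma 9.8] -/
theorem index_negSplitAt_lt {s : LoopSeq d} (hs : ∀ l ∈ s, l ≠ []) (o : InvIdx s) :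
    (s.negSplitAt o).index < s.index := by
  obtain ⟨i, ⟨⟨x, y⟩, hinv⟩⟩ := o
  have hxy : x ≠ y := by
    rintro rfl
    exact DEdge.inv_ne_self _ hinv.symm
  have hg := Word.gap_pos (s.get i) hxy
  have hlt := Word.gap_lt (s.get i) x y
  exact index_replaceAt_two_lt hs i _ _ (a := (s.get i).length - Word.gap (s.get i) x y)
    (b := Word.gap (s.get i) x y) (by omega) hg (by omega)
    ((Word.length_negSplit₁_le _ x y).trans (by omega)) ((Word.length_negSplit₂_le _ x y).trans (by omega))

end LoopSeq

/-- **Chatterjee 2019, Lemma 9.8 — PROVED.** Splitting lowers the index: for a loop sequence `s` (minimal representation)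
and any positive or negative splitting `s'` of `s`, `ι(s') < ι(s)`.  As in print: a splitting of the component `lᵢ` at
locations `x ≠ y` replaces `lᵢ` by the nonbacktracking cores of two complementary arcs (total length `≤ |lᵢ|`, Lemma 9.5),
and the component count goes up by one (Lemma 9.3) unless a core is null, in which case the length drops by at least the
corresponding arc instead. [cite: Chatterjee2019LargeN, Lemma 9.8] -/
theorem SplittingLowersIndex_holds : ∀ d : ℕ, SplittingLowersIndex d := by
  intro d _ s hs
  have hs' : ∀ l ∈ s, l ≠ [] := fun l hl => (hs l hl).2
  exact ⟨fun o => LoopSeq.index_posSplitAt_lt hs' o, fun o => LoopSeq.index_negSplitAt_lt hs' o⟩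

/-! ### v1.4 (append-only, 2026-08-27): Corollary 10.4 PROVED — `SymmetrizedCoeffRecursion_holds`; `𝒳ₖ(s)` IS FINITE

(1) Length bookkeeping of the deformations (`|l ⊕ₓ p|, |l ⊖ₓ p| ≤ |l| + 4`, Lemma 9.5) ⇒ a deformation raises `ι` by at
most `5`, a splitting lowers it (Lemma 9.8, v1.3) ⇒ a vanishing trajectory from `s` with `δ(X)` deformations has at most
`ι(s) + 6δ(X)` steps (minimal representation; `|s| + 6δ(X) + 5` in general) ⇒ `Trajectory.finite_steps_le`,
`finite_trajectoryWith` (`𝒳ₖ(s)` is finite: the «finite sum» of Corollary 3.5 / termination in Proposition 4.1).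
(2) `Trajectory.consEquiv`: for non-null `s` and `k ≥ 1`, `𝒳ₖ(s) ≃ Σ_{moves s ↝ s'} 𝒳_{k−δ(s,s')}(s')`; with
`v(X) = v(s,s')·v(tail)` and finiteness, `a_k(s) = Σ_{s'} v(s,s') a_{k−δ}(s')`, which sorted by the four kinds of moves
(`Move.equivSum`) is Corollary 10.4 verbatim. -/

namespace Word

/-- A positive merger of rotated operands is no longer than the two operands together.
[cite: Chatterjee2019LargeN, §2.2 (positive merger), Lemma 9.5] -/
theorem length_posMergeRot_le : ∀ L M : Word d, (posMergeRot L M).length ≤ L.length + M.length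
  | [], M => by simp [posMergeRot]
  | e :: b, [] => by simp [posMergeRot]
  | e :: b, a :: d' => by
    rw [posMergeRot]
    by_cases h : a.2 = e.2
    · rw [if_pos h]
      refine (length_core_le _).trans ?_
      simp [List.length_append]; omega
    · rw [if_neg h]
      refine (length_core_le _).trans ?_
      simp [List.length_append]; omega

/-- A negative merger of rotated operands is no longer than the two operands together.
[cite: Chatterjee2019LargeN, §2.2 (negative merger), Lemma 9.5] -/
theorem length_negMergeRot_le : ∀ L M : Word d, (negMergeRot L M).length ≤ L.length + M.length
  | [], M => by simp [negMergeRot]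
  | e :: b, [] => by simp [negMergeRot]
  | e :: b, a :: d' => by
    rw [negMergeRot]
    by_cases h : a.2 = e.2
    · rw [if_pos h]
      refine (length_core_le _).trans ?_
      simp [List.length_append]; omega
    · rw [if_neg h]
      refine (length_core_le _).trans ?_
      simp [List.length_append]; omega

/-- `|l ⊕ₓ p| ≤ |l| + 4`. [cite: Chatterjee2019LargeN, §2.2 (deformations), Lemma 9.5] -/
theorem length_posDeform_le (l : Word d) (x : Fin l.length) (p : ZdPlaquette d) :
    (posDeform l x p).length ≤ l.length + 4 := by
  refine (length_posMergeRot_le _ _).trans ?_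
  rw [List.length_rotate, List.length_rotate, length_plaquetteWord]

/-- `|l ⊖ₓ p| ≤ |l| + 4`. [cite: Chatterjee2019LargeN, §2.2 (deformations), Lemma 9.5] -/
theorem length_negDeform_le (l : Word d) (x : Fin l.length) (p : ZdPlaquette d) :
    (negDeform l x p).length ≤ l.length + 4 := by
  refine (length_negMergeRot_le _ _).trans ?_
  rw [List.length_rotate, List.length_rotate, length_plaquetteWord]

end Word

namespace LoopSeq

/-- The result of a replacement is in minimal representation (no null component). [cite: Chatterjee2019LargeN, §2.1 (minimal representation)] -/
theorem ne_nil_of_mem_replaceAt (s : LoopSeq d) (i : ℕ) (ws : List (Word d)) :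
    ∀ l ∈ s.replaceAt i ws, l ≠ [] := by
  intro l hl
  unfold replaceAt prune at hl
  simpa using (List.mem_filter.mp hl).2

/-- Length bookkeeping of a replacement: `|s'| + |lᵢ| = |s| + Σ |w|`. [cite: Chatterjee2019LargeN, Lemma 9.5] -/
theorem len_replaceAt (s : LoopSeq d) (i : Fin s.length) (ws : List (Word d)) :
    len (s.replaceAt i ws) + (s.get i).length = len s + len ws := by
  have hsplit : s = s.take i ++ s.get i :: s.drop (i + 1) := by
    rw [List.get_eq_getElem, List.cons_getElem_drop_succ, List.take_append_drop]
  rw [replaceAt, len_prune, len_append, len_append]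
  conv_rhs => rw [hsplit, len_append, len_cons]
  ring

/-- **Index bookkeeping for a one-word replacement**: replacing `lᵢ` by one word of length `≤ |lᵢ| + 4` (null result
deleted) raises `ι` by at most `5`. [cite: Chatterjee2019LargeN, Lemma 9.5 (a deformation changes the length by at most four)] -/
theorem index_replaceAt_one_le {s : LoopSeq d} (hs : ∀ l ∈ s, l ≠ []) (i : Fin s.length) (w : Word d)
    (hw : w.length ≤ (s.get i).length + 4) : index (s.replaceAt i [w]) ≤ index s + 5 := by
  set A := s.take i with hA
  set B := s.drop (i + 1) with hB
  have hsplit : s = A ++ s.get i :: B := by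
    rw [hA, hB, List.get_eq_getElem, List.cons_getElem_drop_succ, List.take_append_drop]
  have hAmem : ∀ l ∈ A, l ≠ [] := fun l hl => hs l (List.mem_of_mem_take hl)
  have hBmem : ∀ l ∈ B, l ≠ [] := fun l hl => hs l (List.mem_of_mem_drop hl)
  have hrep : s.replaceAt i [w] = A ++ prune [w] ++ B := by
    rw [replaceAt, prune, List.filter_append, List.filter_append, ← prune, ← prune, ← prune,
      prune_eq_self hAmem, prune_eq_self hBmem]
  have hlenS : len s = len A + ((s.get i).length + len B) := by
    conv_lhs => rw [hsplit]
    rw [len_append, len_cons]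
  have hsizeS : size s = size A + (1 + size B) := by
    conv_lhs => rw [hsplit]
    rw [size_append]; simp [size]; ring
  have hlenR : len (s.replaceAt i [w]) = len A + (w.length + len B) := by
    rw [hrep, len_append, len_append, len_prune, len_cons, len_nil]; ring
  have hsizeR : size (s.replaceAt i [w]) = size A + (size (prune [w]) + size B) := by
    rw [hrep, size_append, size_append, add_assoc]
  have hA' := size_le_len hAmem
  have hB' := size_le_len hBmem
  have hδ : size (prune [w]) ≤ 1 := by
    unfold prune size
    by_cases e1 : w = [] <;> simp [e1]
  unfold index
  rw [hlenR, hsizeR, hlenS, hsizeS]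
  omega

end LoopSeq

namespace Move

variable {s : LoopSeq d}

/-- The result of a move is in minimal representation. [cite: Chatterjee2019LargeN, §2.2 (operations produce minimal representations)] -/
theorem ne_nil_of_mem_result : ∀ (m : Move s), ∀ l ∈ m.result, l ≠ []
  | posDeform _ => LoopSeq.ne_nil_of_mem_replaceAt s _ _
  | negDeform _ => LoopSeq.ne_nil_of_mem_replaceAt s _ _
  | posSplit _ => LoopSeq.ne_nil_of_mem_replaceAt s _ _
  | negSplit _ => LoopSeq.ne_nil_of_mem_replaceAt s _ _

/-- `|s'| ≤ |s| + 4` for every move `s ↝ s'`. [cite: Chatterjee2019LargeN, Lemma 9.5] -/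
theorem len_result_le : ∀ m : Move s, m.result.len ≤ s.len + 4
  | posDeform o => by
    have h := LoopSeq.len_replaceAt s o.1 [Word.posDeform (s.get o.1) o.2.1 o.2.2.1]
    have h' := Word.length_posDeform_le (s.get o.1) o.2.1 o.2.2.1
    simp only [LoopSeq.len_cons, LoopSeq.len_nil] at h
    simp only [result, LoopSeq.posDeformAt]; omega
  | negDeform o => by
    have h := LoopSeq.len_replaceAt s o.1 [Word.negDeform (s.get o.1) o.2.1 o.2.2.1]
    have h' := Word.length_negDeform_le (s.get o.1) o.2.1 o.2.2.1
    simp only [LoopSeq.len_cons, LoopSeq.len_nil] at h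
    simp only [result, LoopSeq.negDeformAt]; omega
  | posSplit o => by
    have h := LoopSeq.len_replaceAt s o.1
      [Word.posSplit₁ (s.get o.1) o.2.1.1 o.2.1.2, Word.posSplit₂ (s.get o.1) o.2.1.1 o.2.1.2]
    have h1 := Word.length_posSplit₁_le (s.get o.1) o.2.1.1 o.2.1.2
    have h2 := Word.length_posSplit₂_le (s.get o.1) o.2.2.1
    have h3 := Word.gap_lt (s.get o.1) o.2.1.1 o.2.1.2
    simp only [LoopSeq.len_cons, LoopSeq.len_nil] at h
    simp only [result, LoopSeq.posSplitAt]; omega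
  | negSplit o => by
    have h := LoopSeq.len_replaceAt s o.1
      [Word.negSplit₁ (s.get o.1) o.2.1.1 o.2.1.2, Word.negSplit₂ (s.get o.1) o.2.1.1 o.2.1.2]
    have h1 := Word.length_negSplit₁_le (s.get o.1) o.2.1.1 o.2.1.2
    have h2 := Word.length_negSplit₂_le (s.get o.1) o.2.1.1 o.2.1.2
    have h3 := Word.gap_lt (s.get o.1) o.2.1.1 o.2.1.2
    simp only [LoopSeq.len_cons, LoopSeq.len_nil] at h
    simp only [result, LoopSeq.negSplitAt]; omega

/-- **Index bookkeeping along a move** (from minimal representation): a splitting lowers `ι` by at least `1`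
(Lemma 9.8), a deformation raises it by at most `5`. [cite: Chatterjee2019LargeN, Lemma 9.8, Lemma 9.5] -/
theorem index_result_le (hs : ∀ l ∈ s, l ≠ []) :
    ∀ m : Move s, m.result.index + 1 ≤ s.index + (if m.isDeform then 6 else 0)
  | posDeform o => by
    have := LoopSeq.index_replaceAt_one_le hs o.1 _ (Word.length_posDeform_le (s.get o.1) o.2.1 o.2.2.1)
    simp only [isDeform, result, LoopSeq.posDeformAt, if_true] at this ⊢; omega
  | negDeform o => by
    have := LoopSeq.index_replaceAt_one_le hs o.1 _ (Word.length_negDeform_le (s.get o.1) o.2.1 o.2.2.1)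
    simp only [isDeform, result, LoopSeq.negDeformAt, if_true] at this ⊢; omega
  | posSplit o => by
    have := LoopSeq.index_posSplitAt_lt hs o
    simp only [isDeform, result]; omega
  | negSplit o => by
    have := LoopSeq.index_negSplitAt_lt hs o
    simp only [isDeform, result]; omega

/-- The number of deformation steps contributed by a move: `1` for a deformation, `0` for a splitting (so that
`δ(s₀, s₁, …) = dcount(s₀ ↝ s₁) + δ(s₁, …)`). [cite: Chatterjee2019LargeN, §2.2 (δ(X))] -/
abbrev dcount (m : Move s) : ℕ := if m.isDeform then 1 else 0

/-- The four kinds of moves as a sum type, forward map. [cite: Chatterjee2019LargeN, §2.2 (𝔻^±(s), 𝕊^±(s))] -/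
def toSum : Move s → (DeformIdx s ⊕ DeformIdx s) ⊕ (SameIdx s ⊕ InvIdx s)
  | posDeform o => Sum.inl (Sum.inl o)
  | negDeform o => Sum.inl (Sum.inr o)
  | posSplit o => Sum.inr (Sum.inl o)
  | negSplit o => Sum.inr (Sum.inr o)

/-- The four kinds of moves as a sum type, backward map. [cite: Chatterjee2019LargeN, §2.2 (𝔻^±(s), 𝕊^±(s))] -/
def ofSum : (DeformIdx s ⊕ DeformIdx s) ⊕ (SameIdx s ⊕ InvIdx s) → Move s
  | Sum.inl (Sum.inl o) => posDeform o
  | Sum.inl (Sum.inr o) => negDeform o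
  | Sum.inr (Sum.inl o) => posSplit o
  | Sum.inr (Sum.inr o) => negSplit o

/-- The four kinds of moves as a sum type (for counting with multiplicity). [cite: Chatterjee2019LargeN, §2.2 (𝔻^±(s), 𝕊^±(s))] -/
def equivSum : Move s ≃ (DeformIdx s ⊕ DeformIdx s) ⊕ (SameIdx s ⊕ InvIdx s) where
  toFun := toSum
  invFun := ofSum
  left_inv m := by cases m <;> rfl
  right_inv x := by rcases x with (o | o) | (o | o) <;> rfl

/-- There are finitely many moves out of a loop sequence. [cite: Chatterjee2019LargeN, §2.2 (the sets 𝔻^±(s), 𝕊^±(s) are finite)] -/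
theorem finite (s : LoopSeq d) : Finite (Move s) :=
  Finite.of_equiv _ (equivSum (s := s)).symm

end Move

namespace Trajectory

/-- **Steps bound** (minimal representation): a vanishing trajectory with `δ(X)` deformations has at most
`ι(s) + 6 δ(X)` steps (each splitting lowers the index, Lemma 9.8; each deformation raises it by `≤ 5`).
[cite: Chatterjee2019LargeN, Lemma 9.8, proof of Proposition 4.1 (§10: the recursion terminates)] -/
theorem steps_le_index : ∀ {s : LoopSeq d} (_ : ∀ l ∈ s, l ≠ []) (X : Trajectory s),
    X.steps ≤ s.index + 6 * X.numDeform
  | _, _, nil => by simp [steps]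
  | _, hs, cons m X => by
    have ih := steps_le_index (Move.ne_nil_of_mem_result m) X
    have hm := Move.index_result_le hs m
    simp only [steps, numDeform]
    cases hd : m.isDeform
    · simp only [hd, Bool.false_eq_true, if_false] at hm ⊢; omega
    · simp only [hd, if_true] at hm ⊢; omega

/-- **Steps bound** (any list of words): `steps(X) ≤ |s| + 6 δ(X) + 5`. [cite: Chatterjee2019LargeN, proof of Proposition 4.1 (§10)] -/
theorem steps_le : ∀ {s : LoopSeq d} (X : Trajectory s), X.steps ≤ s.len + 6 * X.numDeform + 5
  | _, nil => by simp [steps]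
  | _, cons m X => by
    have h1 := steps_le_index (Move.ne_nil_of_mem_result m) X
    have h2 : m.result.index ≤ m.result.len := Nat.sub_le _ _
    have h3 := Move.len_result_le m
    simp only [steps, numDeform]
    split <;> omega

/-- First move and tail of a non-trivial trajectory, with the steps budget decremented. [cite: Chatterjee2019LargeN, §2.2 (trajectories)] -/
def unconsLE (n : ℕ) : {s : LoopSeq d} → (X : Trajectory s) → X.steps ≤ n + 1 →
    Option (Σ m : Move s, {Y : Trajectory m.result // Y.steps ≤ n})
  | _, nil, _ => none
  | _, cons m Y, h => some ⟨m, ⟨Y, by simp only [steps] at h; omega⟩⟩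

/-- `unconsLE` is injective on the trajectories of bounded steps. [folklore] -/
private theorem unconsLE_injective (n : ℕ) {s : LoopSeq d} :
    Function.Injective (fun X : {X : Trajectory s // X.steps ≤ n + 1} => unconsLE n X.1 X.2) := by
  rintro ⟨X, hX⟩ ⟨X', hX'⟩ h
  cases X with
  | nil =>
    cases X' with
    | nil => rfl
    | cons m' Y' => simp [unconsLE] at h
  | cons m Y =>
    cases X' with
    | nil => simp [unconsLE] at h
    | cons m' Y' =>
      simp only [unconsLE, Option.some.injEq] at h
      obtain ⟨rfl, h2⟩ := Sigma.mk.inj_iff.mp h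
      simp only [heq_eq_eq, Subtype.mk.injEq] at h2
      subst h2
      rfl

/-- Trajectories with a bounded number of steps form a finite set. [cite: Chatterjee2019LargeN, §2.2 (𝒳(s)), Cor. 3.5 («a finite sum»)] -/
theorem finite_steps_le : ∀ (n : ℕ) (s : LoopSeq d), Finite {X : Trajectory s // X.steps ≤ n}
  | 0, s => by
    refine @Finite.of_subsingleton _ ⟨fun ⟨X, hX⟩ ⟨X', hX'⟩ => ?_⟩
    cases X with
    | nil =>
      cases X' with
      | nil => rfl
      | cons m Y => simp [steps] at hX'
    | cons m Y => simp [steps] at hX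
  | n + 1, s => by
    haveI := Move.finite s
    haveI : ∀ m : Move s, Finite {Y : Trajectory m.result // Y.steps ≤ n} := fun m => finite_steps_le n _
    exact Finite.of_injective _ (unconsLE_injective n)

end Trajectory

/-- **`𝒳ₖ(s)` is finite** (so that `a_k(s) = Σ_{X ∈ 𝒳ₖ(s)} v(X)` is a finite sum, as the source says).
[cite: Chatterjee2019LargeN, Cor. 3.5 («a finite sum»), proof of Proposition 4.1 (§10)] -/
theorem finite_trajectoryWith (s : LoopSeq d) (k : ℕ) : Finite (TrajectoryWith s k) := by
  haveI := Trajectory.finite_steps_le (s.len + 6 * k + 5) s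
  refine Finite.of_injective (fun X : TrajectoryWith s k =>
    (⟨X.1, by have := Trajectory.steps_le X.1; rw [X.2] at this; exact this⟩ :
      {X : Trajectory s // X.steps ≤ s.len + 6 * k + 5})) ?_
  rintro ⟨X, hX⟩ ⟨X', hX'⟩ h
  simp only [Subtype.mk.injEq] at h
  subst h; rfl

/-! #### The first-move decomposition of `𝒳ₖ(s)` for non-null `s` and `k ≥ 1` -/

namespace Trajectory

/-- Split a trajectory out of a non-null `s` into its first move and its tail. [cite: Chatterjee2019LargeN, §2.2 (trajectories)] -/
def headTail : {s : LoopSeq d} → (X : Trajectory s) → s ≠ [] → Σ m : Move s, Trajectory m.result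
  | _, nil, h => absurd rfl h
  | _, cons m X, _ => ⟨m, X⟩

/-- Reassembling the first move and the tail gives the trajectory back. [folklore] -/
private theorem cons_headTail : ∀ {s : LoopSeq d} (X : Trajectory s) (h : s ≠ []),
    cons (X.headTail h).1 (X.headTail h).2 = X
  | _, nil, h => absurd rfl h
  | _, cons _ _, _ => rfl

/-- `δ(X) = δ(first move) + δ(tail)`. [folklore] -/
private theorem numDeform_headTail : ∀ {s : LoopSeq d} (X : Trajectory s) (h : s ≠ []),
    X.numDeform = (X.headTail h).1.dcount + (X.headTail h).2.numDeform
  | _, nil, h => absurd rfl h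
  | _, cons _ _, _ => rfl

/-- **First-move decomposition**: for non-null `s` and `k ≥ 1`, `𝒳ₖ(s) ≃ Σ_{s ↝ s'} 𝒳_{k − δ(s,s')}(s')`.
[cite: Chatterjee2019LargeN, Corollary 10.4 (proof: condition on the first step of the trajectory)] -/
def consEquiv {s : LoopSeq d} (hs : s ≠ []) {k : ℕ} (hk : 1 ≤ k) :
    TrajectoryWith s k ≃ Σ m : Move s, TrajectoryWith m.result (k - m.dcount) where
  toFun X := ⟨(X.1.headTail hs).1, ⟨(X.1.headTail hs).2, by
    have h := numDeform_headTail X.1 hs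
    rw [X.2] at h
    omega⟩⟩
  invFun p := ⟨cons p.1 p.2.1, by
    have h := p.2.2
    simp only [numDeform]
    unfold Move.dcount at h
    split_ifs at h ⊢ <;> omega⟩
  left_inv X := by
    apply Subtype.ext
    exact cons_headTail X.1 hs
  right_inv p := by
    rcases p with ⟨m, ⟨Y, hY⟩⟩
    rfl

end Trajectory

/-- **Chatterjee 2019, Corollary 10.4 — PROVED** (the symmetrized recursion for the strong-coupling coefficients): for
non-null `s` and `k ≥ 1`, conditioning the finite sum `a_k(s) = Σ_{X ∈ 𝒳ₖ(s)} v(X)` on the first move `s ↝ s'` of the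
trajectory (weight `∓1/|s|`, one deformation used up by a deformation move, none by a splitting) gives
`a_k(s) = |s|⁻¹ (Σ_{𝕊⁻} a_k(s') − Σ_{𝕊⁺} a_k(s') + Σ_{𝔻⁻} a_{k−1}(s') − Σ_{𝔻⁺} a_{k−1}(s'))`.  (In print this is read off
the marked-edge recursion by averaging over the edge; here it is the first-step identity of the trajectory sum, available
because `𝒳ₖ(s)` is finite — `finite_trajectoryWith`, from Lemma 9.8.) [cite: Chatterjee2019LargeN, Corollary 10.4] -/
theorem SymmetrizedCoeffRecursion_holds : ∀ d : ℕ, SymmetrizedCoeffRecursion d := by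
  intro d _ s _ hs k hk
  classical
  haveI hfin : ∀ (t : LoopSeq d) (j : ℕ), Fintype (TrajectoryWith t j) := fun t j =>
    @Fintype.ofFinite _ (finite_trajectoryWith t j)
  letI : Fintype (Move s) := Fintype.ofEquiv _ (Move.equivSum (s := s)).symm
  have hco : ∀ (t : LoopSeq d) (j : ℕ), coeffA t j = ∑ X : TrajectoryWith t j, X.1.vweight := fun t j =>
    tsum_fintype _
  -- first-move decomposition of the finite sum
  have h1 : coeffA s k = ∑ m : Move s, m.vweight * coeffA m.result (k - m.dcount) := by
    rw [hco, ← (Trajectory.consEquiv hs hk).symm.sum_comp, Fintype.sum_sigma]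
    refine Finset.sum_congr rfl fun m _ => ?_
    rw [hco, Finset.mul_sum]
    refine Finset.sum_congr rfl fun Y _ => ?_
    rfl
  -- split the sum over the four kinds of moves
  have h2 : ∑ m : Move s, m.vweight * coeffA m.result (k - m.dcount) =
      ((∑ o : DeformIdx s, (-1 / (s.len : ℝ)) * coeffA (s.posDeformAt o) (k - 1)) +
        ∑ o : DeformIdx s, (1 / (s.len : ℝ)) * coeffA (s.negDeformAt o) (k - 1)) +
      ((∑ o : SameIdx s, (-1 / (s.len : ℝ)) * coeffA (s.posSplitAt o) k) +
        ∑ o : InvIdx s, (1 / (s.len : ℝ)) * coeffA (s.negSplitAt o) k) := by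
    rw [← (Move.equivSum (s := s)).symm.sum_comp, Fintype.sum_sum_type, Fintype.sum_sum_type, Fintype.sum_sum_type]
    rfl
  rw [h1, h2]
  simp only [← Finset.mul_sum]
  ring

end Literature.MathematicalPhysics.QuantumFieldTheory.Chatterjee2019LargeN

end
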